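import Summits.AtomisticToContinuum.FouriersLaw.Theorems.HiddenChargeMazurOddChargeAlgebraSymbolMonomial

/-!
# Odd conservation laws of the pinned anharmonic chain — the symbol calculus of `N ∘ L₊`

For a left-aligned polynomial `f` (`N f = f`) of maximal span `≤ D` (`D ≥ 1`) the two leading
classes of `N (L₊ f)` are explicit:

* (SC1) `projSD (D+1) e (N (L₊ f)) = β · B↑_D (projSD D (e+1) f)` — only the two boundary
  interaction terms raise the span;
* (SC2) if `f` has no class-`(D, e+1)` part and `e ≥ 2`:
  `projSD D e (N (L₊ f)) = A⁺ (projSD D (e-1) f) + β · B↑_{D-1} (projSD (D-1) (e+1) f)`.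

This is the only place where the locality of the chain enters the classification of the odd
conservation laws.  Proof: linearity reduces to polynomials of pure class `(s, d)`, where every term
of `L₊ g = A⁺ g + Σ_x F⁺_x ∂_{p_x} g` has a known class (file `…SymbolMonomial`). [folklore]
-/

noncomputable section

open MvPolynomial Finsupp
open scoped BigOperators

namespace Summit.AtomisticToContinuum.FouriersLaw.Theorems.OddChargeAlgebra

/-! ## The expansion of `L₊` and the realigned left boundary term -/

/-- `L₊ = A⁺ + Σ_x F⁺_x ∂_{p_x}` on polynomials living on the sites of `I`. [folklore] -/
theorem lplus_eq_Aplus_add_sum (lam β : ℝ) (I : Finset ℤ) {g : R}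
    (hg : g ∈ supported ℝ (Var.site ⁻¹' (I : Set ℤ))) :
    lplus lam β g = Aplus g + ∑ x ∈ I, forcePlus lam β x * pderiv (Sum.inr x) g := by
  set D₂ : Derivation ℝ R R := Aplus + ∑ x ∈ I, forcePlus lam β x • pderiv (Sum.inr x) with hD₂
  have key : lplus lam β g = D₂ g := by
    refine derivation_eqOn_supported (fun v hv => ?_) hg
    simp only [Set.mem_preimage, Finset.mem_coe] at hv
    simp only [Function.comp_apply, hD₂, Derivation.add_apply, derivation_sum_apply,
      Derivation.smul_apply, smul_eq_mul, pderiv_X]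
    rcases v with y | y
    · simp [lplus, Aplus, mkDerivation_X]
    · simp only [lplus, Aplus, mkDerivation_X, Sum.elim_inr, zero_add]
      rw [Finset.sum_eq_single_of_mem y hv fun x _ hxy => by simp [hxy]]
      simp
  rw [key, hD₂, Derivation.add_apply, derivation_sum_apply]
  simp only [Derivation.smul_apply, smul_eq_mul]

/-- The quartic force split into pinning, right and left interaction parts. [folklore] -/
theorem forcePlus_mul (lam β : ℝ) (x : ℤ) (P : R) :
    forcePlus lam β x * P = -(C lam + 2 * C β) * (X (Sum.inl x) ^ 3 * P)
      + C β * (cub (X (Sum.inl (x + 1))) (X (Sum.inl x)) * P)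
      + C β * (cub (X (Sum.inl (x - 1))) (X (Sum.inl x)) * P) := by
  simp only [forcePlus, cub]
  ring

/-- Shifting a polynomial of minimal site `-1`. [folklore] -/
theorem pure_shift_of {T : R} {s : ℤ} {d : ℕ}
    (h : ∀ n ∈ T.support, minsite n = -1 ∧ maxsite n = s ∧ weight pwt n + 1 = d) :
    ∀ n ∈ (shift T).support, minsite n = 0 ∧ maxsite n = s + 1 ∧ weight pwt n + 1 = d := by
  classical
  intro n hn
  rw [shift, shiftBy, support_rename_of_injective (transl_injective 1)] at hn
  obtain ⟨m, hm, rfl⟩ := Finset.mem_image.mp hn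
  obtain ⟨h1, h2, h3⟩ := h m hm
  have hm0 : m ≠ 0 := by
    rintro rfl
    rw [minsite_zero] at h1
    omega
  refine ⟨?_, ?_, ?_⟩
  · rw [minsite_mapDomain_transl hm0, h1]; norm_num
  · rw [maxsite_mapDomain_transl hm0, h2]
  · rwa [weight_pwt_mapDomain_transl]

/-- The shifted left boundary term `S(cub q_{-1} q_0 · ∂_{p_0} g)`. [folklore] -/
theorem nf_cubMinus {g : R} {s : ℤ} {d : ℕ}
    (hg : ∀ n ∈ g.support, minsite n = 0 ∧ maxsite n = s ∧ weight pwt n = d) (hsd : 1 ≤ s ∨ 2 ≤ d) :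
    nf (cub (X (Sum.inl (-1))) (X (Sum.inl 0)) * pderiv (Sum.inr 0) g : R) =
      cub (X (Sum.inl 0)) (X (Sum.inl 1)) * shift (pderiv (Sum.inr 0) g) := by
  rw [nf_eq_shiftBy_of (k := 1) fun n hn => (cubMinus_facts hg hsd n hn).1]
  change shift _ = _
  rw [map_mul, shift_cub, shift_X_inl, shift_X_inl]
  norm_num

/-- The realigned left boundary term `cub q_0 q_1 · S(∂_{p_0} g)` has class `(s+1, d-1)`. [folklore] -/
theorem pure_shift_cubMinus {g : R} {s : ℤ} {d : ℕ}
    (hg : ∀ n ∈ g.support, minsite n = 0 ∧ maxsite n = s ∧ weight pwt n = d) (hsd : 1 ≤ s ∨ 2 ≤ d) :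
    ∀ n ∈ (cub (X (Sum.inl 0)) (X (Sum.inl 1)) * shift (pderiv (Sum.inr 0) g) : R).support,
      minsite n = 0 ∧ maxsite n = s + 1 ∧ weight pwt n + 1 = d := by
  rw [← nf_cubMinus hg hsd, nf_eq_shiftBy_of (k := 1) fun n hn => (cubMinus_facts hg hsd n hn).1]
  exact pure_shift_of (cubMinus_facts hg hsd)

/-! ## One force term at a time -/

/-- Constants commute past `projSD ∘ N`, negated-sum form used for the pinning term. [folklore] -/
private theorem projSD_nf_neg_mul (s : ℤ) (e : ℕ) (lam β : ℝ) (T : R) :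
    projSD s e (nf (-(C lam + 2 * C β) * T)) = -(C lam + 2 * C β) * projSD s e (nf T) := by
  have h : (-(C lam + 2 * C β) : R) = C (-(lam + 2 * β)) := by
    simp only [map_neg, map_add, map_mul, map_ofNat]
  rw [h, projSD_nf_C_mul]

/-- (SC1), one site `x`: the class-`(D+1, e)` part of `N (F⁺_x ∂_{p_x} g)` for `g` of pure class
`(s, d)`, `s ≤ D`: only `x = s = D` (right boundary) and `x = 0`, `s = D` (left boundary, after
realignment) contribute. [folklore] -/
theorem projSD_succ_nf_forcePlus_term (lam β : ℝ) {g : R} {s : ℤ} {d : ℕ}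
    (hg : ∀ n ∈ g.support, minsite n = 0 ∧ maxsite n = s ∧ weight pwt n = d) {D : ℤ} (hD : 1 ≤ D)
    (hsD : s ≤ D) {x : ℤ} (hx : x ∈ Finset.Icc 0 s) (e : ℕ) :
    projSD (D + 1) e (nf (forcePlus lam β x * pderiv (Sum.inr x) g)) =
      C β * ((if x = s ∧ s = D ∧ d = e + 1 then
                cub (X (Sum.inl (x + 1))) (X (Sum.inl x)) * pderiv (Sum.inr x) g else 0)
        + (if x = 0 ∧ s = D ∧ d = e + 1 then
                cub (X (Sum.inl 0)) (X (Sum.inl 1)) * shift (pderiv (Sum.inr x) g) else 0)) := by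
  rw [Finset.mem_Icc] at hx
  rw [forcePlus_mul, map_add, map_add, map_add, map_add, projSD_nf_neg_mul, projSD_nf_C_mul,
    projSD_nf_C_mul]
  have h1 : projSD (D + 1) e (nf (X (Sum.inl x) ^ 3 * pderiv (Sum.inr x) g)) = 0 := by
    have hp := pure_X_pow_mul_pderiv hg x
    rw [nf_eq_self_of fun n hn => Or.inr (hp n hn).1, projSD_eq_ite_of_succ hp, if_neg]
    omega
  have h2 : projSD (D + 1) e (nf (cub (X (Sum.inl (x + 1))) (X (Sum.inl x)) * pderiv (Sum.inr x) g))
      = if x = s ∧ s = D ∧ d = e + 1 then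
          cub (X (Sum.inl (x + 1))) (X (Sum.inl x)) * pderiv (Sum.inr x) g else 0 := by
    by_cases hxs : x = s ∧ s = D
    · obtain ⟨rfl, rfl⟩ := hxs
      have hp := pure_cubPlus hg (Or.inl hD)
      rw [nf_eq_self_of fun n hn => Or.inr (hp n hn).1, projSD_eq_ite_of_succ hp]
      simp only [true_and]
    · rw [if_neg fun h => hxs ⟨h.1, h.2.1⟩]
      exact projSD_nf_eq_zero_of_site_mem (a := 0) (b := D) (by omega)
        (sites_cub_mul_pderiv hg ⟨by omega, by omega⟩ ⟨by omega, by omega⟩ le_rfl hsD x)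
        (by omega) e
  have h3 : projSD (D + 1) e (nf (cub (X (Sum.inl (x - 1))) (X (Sum.inl x)) * pderiv (Sum.inr x) g))
      = if x = 0 ∧ s = D ∧ d = e + 1 then
          cub (X (Sum.inl 0)) (X (Sum.inl 1)) * shift (pderiv (Sum.inr x) g) else 0 := by
    by_cases hx0 : x = 0 ∧ s = D
    · obtain ⟨rfl, rfl⟩ := hx0
      rw [zero_sub, nf_cubMinus hg (Or.inl hD),
        projSD_eq_ite_of_succ (pure_shift_cubMinus hg (Or.inl hD))]
      simp only [true_and]
    · rw [if_neg fun h => hx0 ⟨h.1, h.2.1⟩]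
      by_cases hx0' : x = 0
      · subst hx0'
        exact projSD_nf_eq_zero_of_site_mem (a := -1) (b := s) (by omega)
          (sites_cub_mul_pderiv hg ⟨by omega, by omega⟩ ⟨by omega, by omega⟩ (by norm_num) le_rfl 0)
          (by omega) e
      · exact projSD_nf_eq_zero_of_site_mem (a := 0) (b := s) (by omega)
          (sites_cub_mul_pderiv hg ⟨by omega, by omega⟩ ⟨by omega, by omega⟩ le_rfl le_rfl x)
          (by omega) e
  rw [h1, h2, h3, mul_zero, zero_add, mul_add]

/-- `bup D 0 = 0`. [folklore] -/
@[simp] theorem bup_zero (D : ℤ) : bup D 0 = 0 := by simp [bup]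

/-- `bup D` is additive over finite sums. [folklore] -/
theorem bup_sum {ι : Type*} (D : ℤ) (S : Finset ι) (h : ι → R) :
    bup D (∑ i ∈ S, h i) = ∑ i ∈ S, bup D (h i) := by
  simp only [bup, map_sum, Finset.mul_sum, ← Finset.sum_add_distrib]

/-- (SC1) for a polynomial of pure class `(s, d)`, `0 ≤ s ≤ D`, `1 ≤ D`. [folklore] -/
theorem projSD_succ_nf_lplus_pure (lam β : ℝ) {g : R} {s : ℤ} {d : ℕ}
    (hg : ∀ n ∈ g.support, minsite n = 0 ∧ maxsite n = s ∧ weight pwt n = d) {D : ℤ} (hD : 1 ≤ D)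
    (hs : 0 ≤ s) (hsD : s ≤ D) (e : ℕ) :
    projSD (D + 1) e (nf (lplus lam β g)) = C β * bup D (projSD D (e + 1) g) := by
  rw [lplus_eq_Aplus_add_sum lam β _ (mem_supported_of_pure hg), map_add, map_add, map_sum, map_sum,
    Finset.sum_congr rfl fun x hx => projSD_succ_nf_forcePlus_term lam β hg hD hsD hx e]
  have hA : projSD (D + 1) e (nf (Aplus g)) = 0 := by
    rw [nf_eq_self_of_pure (pure_Aplus hg), projSD_eq_ite_of_pure (pure_Aplus hg), if_neg]
    omega
  rw [hA, zero_add, ← Finset.mul_sum, Finset.sum_add_distrib]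
  simp_rw [ite_and]
  rw [Finset.sum_ite_eq', Finset.sum_ite_eq', if_pos (Finset.mem_Icc.mpr ⟨hs, le_rfl⟩),
    if_pos (Finset.mem_Icc.mpr ⟨le_rfl, hs⟩), projSD_eq_ite_of_pure hg]
  by_cases h1 : s = D
  · subst h1
    by_cases h2 : d = e + 1
    · rw [if_pos rfl, if_pos rfl, if_pos h2, if_pos h2, if_pos ⟨rfl, h2⟩, bup]
    · rw [if_pos rfl, if_pos rfl, if_neg h2, if_neg h2, if_neg fun h => h2 h.2, add_zero, mul_zero,
        bup_zero, mul_zero]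
  · rw [if_neg h1, if_neg h1, if_neg fun h => h1 h.1, add_zero, mul_zero, bup_zero, mul_zero]

/-- (SC2), one site `x`: the class-`(D, e)` part of `N (F⁺_x ∂_{p_x} g)` for `g` of pure class
`(s, d) ≠ (D, e+1)`, `s ≤ D`, `e ≥ 2`: only `x = s = D - 1` (right boundary) and `x = 0`, `s = D - 1`
(left boundary, after realignment) contribute. [folklore] -/
theorem projSD_nf_forcePlus_term (lam β : ℝ) {g : R} {s : ℤ} {d : ℕ}
    (hg : ∀ n ∈ g.support, minsite n = 0 ∧ maxsite n = s ∧ weight pwt n = d) {D : ℤ} (hD : 1 ≤ D)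
    (hsD : s ≤ D) {e : ℕ} (he : 2 ≤ e) (hne : ¬(s = D ∧ d = e + 1)) {x : ℤ}
    (hx : x ∈ Finset.Icc 0 s) :
    projSD D e (nf (forcePlus lam β x * pderiv (Sum.inr x) g)) =
      C β * ((if x = s ∧ s + 1 = D ∧ d = e + 1 then
                cub (X (Sum.inl (x + 1))) (X (Sum.inl x)) * pderiv (Sum.inr x) g else 0)
        + (if x = 0 ∧ s + 1 = D ∧ d = e + 1 then
                cub (X (Sum.inl 0)) (X (Sum.inl 1)) * shift (pderiv (Sum.inr x) g) else 0)) := by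
  rw [Finset.mem_Icc] at hx
  rw [forcePlus_mul, map_add, map_add, map_add, map_add, projSD_nf_neg_mul, projSD_nf_C_mul,
    projSD_nf_C_mul]
  have h1 : projSD D e (nf (X (Sum.inl x) ^ 3 * pderiv (Sum.inr x) g)) = 0 := by
    have hp := pure_X_pow_mul_pderiv hg x
    rw [nf_eq_self_of fun n hn => Or.inr (hp n hn).1, projSD_eq_ite_of_succ hp, if_neg hne]
  -- the bulk interaction terms vanish: by momentum degree if `s = D`, by span if `s < D`
  have hvan : ∀ u w : ℤ, u ∈ Set.Icc (0 : ℤ) (D - 1) → w ∈ Set.Icc (0 : ℤ) (D - 1) →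
      projSD D e (nf (cub (X (Sum.inl u)) (X (Sum.inl w)) * pderiv (Sum.inr x) g)) = 0 := by
    intro u w hu hw
    by_cases hsD' : s = D
    · refine projSD_nf_eq_zero_of_weight_ne (fun n hn => ?_) D
      have := weight_cub_mul_pderiv hg u w x n hn
      omega
    · exact projSD_nf_eq_zero_of_site_mem (a := 0) (b := D - 1) (by omega)
        (sites_cub_mul_pderiv hg hu hw le_rfl (by omega) x) (by omega) e
  have h2 : projSD D e (nf (cub (X (Sum.inl (x + 1))) (X (Sum.inl x)) * pderiv (Sum.inr x) g))
      = if x = s ∧ s + 1 = D ∧ d = e + 1 then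
          cub (X (Sum.inl (x + 1))) (X (Sum.inl x)) * pderiv (Sum.inr x) g else 0 := by
    by_cases hxs : x = s ∧ s + 1 = D
    · obtain ⟨rfl, rfl⟩ := hxs
      by_cases hsd : 1 ≤ x ∨ 2 ≤ d
      · have hp := pure_cubPlus hg hsd
        rw [nf_eq_self_of fun n hn => Or.inr (hp n hn).1, projSD_eq_ite_of_succ hp]
        simp only [true_and]
      · rw [if_neg (by omega)]
        refine projSD_nf_eq_zero_of_weight_ne (fun n hn => ?_) _
        have := weight_cub_mul_pderiv hg (x + 1) x x n hn
        omega
    · rw [if_neg fun h => hxs ⟨h.1, h.2.1⟩]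
      by_cases hsD' : s = D
      · refine projSD_nf_eq_zero_of_weight_ne (fun n hn => ?_) D
        have := weight_cub_mul_pderiv hg (x + 1) x x n hn
        omega
      · exact hvan (x + 1) x ⟨by omega, by omega⟩ ⟨by omega, by omega⟩
  have h3 : projSD D e (nf (cub (X (Sum.inl (x - 1))) (X (Sum.inl x)) * pderiv (Sum.inr x) g))
      = if x = 0 ∧ s + 1 = D ∧ d = e + 1 then
          cub (X (Sum.inl 0)) (X (Sum.inl 1)) * shift (pderiv (Sum.inr x) g) else 0 := by
    by_cases hx0 : x = 0 ∧ s + 1 = D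
    · obtain ⟨rfl, rfl⟩ := hx0
      rw [zero_sub]
      by_cases hsd : 1 ≤ s ∨ 2 ≤ d
      · rw [nf_cubMinus hg hsd, projSD_eq_ite_of_succ (pure_shift_cubMinus hg hsd)]
        simp only [true_and]
      · rw [if_neg (by omega)]
        refine projSD_nf_eq_zero_of_weight_ne (fun n hn => ?_) _
        have := weight_cub_mul_pderiv hg (-1) 0 0 n hn
        omega
    · rw [if_neg fun h => hx0 ⟨h.1, h.2.1⟩]
      by_cases hsD' : s = D
      · refine projSD_nf_eq_zero_of_weight_ne (fun n hn => ?_) D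
        have := weight_cub_mul_pderiv hg (x - 1) x x n hn
        omega
      · by_cases hx0' : x = 0
        · subst hx0'
          exact projSD_nf_eq_zero_of_site_mem (a := -1) (b := s) (by omega)
            (sites_cub_mul_pderiv hg ⟨by omega, by omega⟩ ⟨by omega, by omega⟩ (by norm_num)
              le_rfl 0) (by omega) e
        · exact hvan (x - 1) x ⟨by omega, by omega⟩ ⟨by omega, by omega⟩
  rw [h1, h2, h3, mul_zero, zero_add, mul_add]

/-- (SC2) for a polynomial of pure class `(s, d) ≠ (D, e+1)`, `0 ≤ s ≤ D`, `1 ≤ D`, `2 ≤ e`. [folklore] -/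
theorem projSD_nf_lplus_pure (lam β : ℝ) {g : R} {s : ℤ} {d : ℕ}
    (hg : ∀ n ∈ g.support, minsite n = 0 ∧ maxsite n = s ∧ weight pwt n = d) {D : ℤ} (hD : 1 ≤ D)
    (hs : 0 ≤ s) (hsD : s ≤ D) {e : ℕ} (he : 2 ≤ e) (hne : ¬(s = D ∧ d = e + 1)) :
    projSD D e (nf (lplus lam β g)) =
      Aplus (projSD D (e - 1) g) + C β * bup (D - 1) (projSD (D - 1) (e + 1) g) := by
  rw [lplus_eq_Aplus_add_sum lam β _ (mem_supported_of_pure hg), map_add, map_add, map_sum, map_sum,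
    Finset.sum_congr rfl fun x hx => projSD_nf_forcePlus_term lam β hg hD hsD he hne hx]
  rw [nf_eq_self_of_pure (pure_Aplus hg), projSD_eq_ite_of_pure (pure_Aplus hg), ← Finset.mul_sum,
    Finset.sum_add_distrib]
  simp_rw [ite_and]
  rw [Finset.sum_ite_eq', Finset.sum_ite_eq', if_pos (Finset.mem_Icc.mpr ⟨hs, le_rfl⟩),
    if_pos (Finset.mem_Icc.mpr ⟨le_rfl, hs⟩), projSD_eq_ite_of_pure hg, projSD_eq_ite_of_pure hg]
  congr 1
  · by_cases h1 : s = D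
    · by_cases h2 : d + 1 = e
      · rw [if_pos h1, if_pos h2, if_pos ⟨h1, by omega⟩]
      · rw [if_pos h1, if_neg h2, if_neg fun h => h2 (by have := h.2; omega), map_zero]
    · rw [if_neg h1, if_neg fun h => h1 h.1, map_zero]
  · by_cases h1 : s + 1 = D
    · subst h1
      by_cases h2 : d = e + 1
      · rw [if_pos rfl, if_pos rfl, if_pos h2, if_pos h2, if_pos ⟨by omega, h2⟩,
          add_sub_cancel_right, bup]
      · rw [if_pos rfl, if_pos rfl, if_neg h2, if_neg h2, if_neg fun h => h2 h.2, add_zero,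
          mul_zero, bup_zero, mul_zero]
    · rw [if_neg h1, if_neg h1, if_neg fun h => h1 (by have := h.1; omega), add_zero, mul_zero,
        bup_zero, mul_zero]

/-! ## The headlines -/

/-- A monomial of a left-aligned polynomial is of pure class `(maxsite, momentum degree)`. [folklore] -/
theorem pure_monomial_of_nf_eq_self {f : R} (hf : nf f = f) {m : Var →₀ ℕ} (hm : m ∈ f.support)
    (c : ℝ) : ∀ n ∈ (monomial m c).support,
      minsite n = 0 ∧ maxsite n = maxsite m ∧ weight pwt n = weight pwt m := by
  classical
  intro n hn
  obtain rfl : n = m := Finset.mem_singleton.mp (support_monomial_subset hn)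
  refine ⟨?_, rfl, rfl⟩
  rcases nf_eq_self_iff.mp hf n hm with rfl | h
  · exact minsite_zero
  · exact h

/-- (SC1) The class-`(D+1, e)` part of `N (L₊ f)` for a left-aligned `f` of span `≤ D`:
`projSD (D+1) e (N (L₊ f)) = β · B↑_D (projSD D (e+1) f)`. [folklore] -/
theorem projSD_succ_nf_lplus : ∀ (lam β : ℝ) (f : R) (D : ℤ) (e : ℕ), 1 ≤ D → nf f = f →
    (∀ m ∈ f.support, maxsite m ≤ D) →
    projSD (D + 1) e (nf (lplus lam β f)) = C β * bup D (projSD D (e + 1) f) := by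
  intro lam β f D e hD hf hmax
  conv_lhs => rw [f.as_sum]
  conv_rhs => rw [f.as_sum]
  rw [map_sum, map_sum, map_sum, map_sum, bup_sum, Finset.mul_sum]
  refine Finset.sum_congr rfl fun m hm => ?_
  have h0 : 0 ≤ maxsite m := by
    have := minsite_le_maxsite m
    rcases nf_eq_self_iff.mp hf m hm with rfl | h
    · simp
    · omega
  exact projSD_succ_nf_lplus_pure lam β (pure_monomial_of_nf_eq_self hf hm _) hD h0 (hmax m hm) e

/-- (SC2) The class-`(D, e)` part of `N (L₊ f)` for a left-aligned `f` of span `≤ D` without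
class-`(D, e+1)` part, `e ≥ 2`:
`projSD D e (N (L₊ f)) = A⁺ (projSD D (e-1) f) + β · B↑_{D-1} (projSD (D-1) (e+1) f)`. [folklore] -/
theorem projSD_nf_lplus : ∀ (lam β : ℝ) (f : R) (D : ℤ) (e : ℕ), 1 ≤ D → 2 ≤ e → nf f = f →
    (∀ m ∈ f.support, maxsite m ≤ D) → projSD D (e + 1) f = 0 →
    projSD D e (nf (lplus lam β f)) =
      Aplus (projSD D (e - 1) f) + C β * bup (D - 1) (projSD (D - 1) (e + 1) f) := by
  intro lam β f D e hD he hf hmax hzero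
  conv_lhs => rw [f.as_sum]
  conv_rhs => rw [f.as_sum]
  rw [map_sum, map_sum, map_sum, map_sum, map_sum, map_sum, bup_sum, Finset.mul_sum,
    ← Finset.sum_add_distrib]
  refine Finset.sum_congr rfl fun m hm => ?_
  have h0 : 0 ≤ maxsite m := by
    have := minsite_le_maxsite m
    rcases nf_eq_self_iff.mp hf m hm with rfl | h
    · simp
    · omega
  have hne : ¬(maxsite m = D ∧ weight pwt m = e + 1) := fun h => by
    have hc := congrArg (coeff m) hzero
    rw [coeff_projSD_of_nf_eq_self hf, if_pos h, coeff_zero] at hc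
    exact (MvPolynomial.mem_support_iff.mp hm) hc
  exact projSD_nf_lplus_pure lam β (pure_monomial_of_nf_eq_self hf hm _) hD h0 (hmax m hm) he hne

end Summit.AtomisticToContinuum.FouriersLaw.Theorems.OddChargeAlgebra

end
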